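import Summits.Ventures.Crystal3D.Theorems.StickyWulffConstantCoaxialWallLawTwinCage
import Summits.Ventures.Crystal3D.Theorems.StickyWulffConstantCoaxialWallLawTwinCageLocalCore
import Summits.Ventures.Crystal3D.Theorems.StickyWulffConstantCoaxialWallLawKissingCageLocal
import HarnessLib

/-!
# The LOCAL twin (hcp) cage and the divacancy law at twin hosts (crux `CoaxialWallLaw`, 19481, line `WallLedgerF`)

HONEST FRAMING. Venture `Summits/Ventures/Crystal3D` (cell `crystal3d-full`), helper `--supports` the crux `CoaxialWallLaw`
(stmt-Ventures-19481), REGISTERED line `WallLedgerF` (cf-p1 (lvi)/(lxii)/(lxxi): bricks for the OFF-MODULE tail).  Rung credit;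
F-C1 not moved; census-free.  Twin analogue of `…KissingCageLocal` on top of `…TwinCage` and `…TwinCageLocalCore`; the TWIN
DOZEN of `(G, m)` is `{G w : ⟪G w, m⟫ ≤ 0} ∪ {G w − 2⟪G w, m⟫ m : ⟪G w, m⟫ < 0}`.
* `twin_slot_eq`, `twin_mirror_eq` (`x·τ = 6⟪t, d⟫`), `inner_twin_SS/MS/MM` (`18⟪d, d′⟫ = τ·τ′`), `twin_cover_core`,
  **`exists_twinMember_inner_ge_half`** (the dozen's closed `60°`-caps cover the sphere);
* **`eq_of_twin_local_cage`** — unit `t` with `⟪t, d₀⟫ ≥ ½` and `⟪t, d⟫ ≤ ½` for the members `d` adjacent to `d₀` IS `d₀`;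
* **`foreign_contact_twin_adjacent_divacancy`** — `X` `1`-separated, `x ∈ X` touching a twin host `y` off its dozen ⇒ two
  ADJACENT dozen positions vacant at `y`, both strictly blocked by `x`; `contact_on_twinDozen_of_no_adjacent_divacancy`.
-/

noncomputable section

namespace Summit.Ventures.Crystal3D.Theorems

open Summit.Ventures.Crystal3D Finset NearIdentity
open scoped InnerProductSpace

/-- `x·(3 sₗ c) = 6⟪t, G sₗ⟫` in signed cubic coordinates. -/
theorem twin_slot_eq (G : EuclideanSpace ℝ (Fin 3) ≃ₗᵢ[ℝ] EuclideanSpace ℝ (Fin 3)) (c : Fin 8)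
    (t : EuclideanSpace ℝ (Fin 3)) (l : Fin 12) :
    Real.sqrt 2 * cubeInt c 0 * cubicCoords (G.symm t) 0 * ((3 * (slotInt l 0 * cubeInt c 0) : ℤ) : ℝ) +
      Real.sqrt 2 * cubeInt c 1 * cubicCoords (G.symm t) 1 * ((3 * (slotInt l 1 * cubeInt c 1) : ℤ) : ℝ) +
      Real.sqrt 2 * cubeInt c 2 * cubicCoords (G.symm t) 2 * ((3 * (slotInt l 2 * cubeInt c 2) : ℤ) : ℝ) =
      6 * ⟪t, G (slotSite l)⟫_ℝ := by
  have e : ⟪t, G (slotSite l)⟫_ℝ = ⟪G.symm t, slotSite l⟫_ℝ := by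
    rw [← G.inner_map_map (G.symm t) (slotSite l), G.apply_symm_apply]
  have h2p : 0 < Real.sqrt 2 := Real.sqrt_pos.2 (by norm_num)
  have h22 : Real.sqrt 2 ^ 2 = 2 := Real.sq_sqrt (by norm_num)
  rw [e, inner_slotSite_right]
  have hc2 : ∀ i, ((cubeInt c i : ℤ) : ℝ) * (cubeInt c i : ℤ) = 1 := fun i => by
    rcases cubeInt_pm_one c i with h | h <;> simp [h]
  have key : ∀ i, Real.sqrt 2 * cubeInt c i * cubicCoords (G.symm t) i * ((3 * (slotInt l i * cubeInt c i) : ℤ) : ℝ) =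
      3 * Real.sqrt 2 * (cubicCoords (G.symm t) i * slotInt l i) := by
    intro i; push_cast
    linear_combination (3 * Real.sqrt 2 * cubicCoords (G.symm t) i * slotInt l i) * hc2 i
  rw [key 0, key 1, key 2]
  field_simp
  rw [h22]; ring

/-- `x·(3 sₗ c + 4) = 6⟪t, G sₗ − 2⟪G sₗ, m⟫ m⟫` for a mirror member (`sₗ·c = −2`). -/
theorem twin_mirror_eq {G : EuclideanSpace ℝ (Fin 3) ≃ₗᵢ[ℝ] EuclideanSpace ℝ (Fin 3)} {m : EuclideanSpace ℝ (Fin 3)}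
    {c : Fin 8} (hc : cubicCoords (G.symm m) = fun j => (cubeInt c j : ℝ) / Real.sqrt 3)
    (t : EuclideanSpace ℝ (Fin 3)) (l : Fin 12) (hsum : sdot3 (slotInt l) (cubeInt c) = -2) :
    Real.sqrt 2 * cubeInt c 0 * cubicCoords (G.symm t) 0 * ((3 * (slotInt l 0 * cubeInt c 0) + 4 : ℤ) : ℝ) +
      Real.sqrt 2 * cubeInt c 1 * cubicCoords (G.symm t) 1 * ((3 * (slotInt l 1 * cubeInt c 1) + 4 : ℤ) : ℝ) +
      Real.sqrt 2 * cubeInt c 2 * cubicCoords (G.symm t) 2 * ((3 * (slotInt l 2 * cubeInt c 2) + 4 : ℤ) : ℝ) =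
      6 * ⟪t, G (slotSite l) - (2 * ⟪G (slotSite l), m⟫_ℝ) • m⟫_ℝ := by
  have e1 : ⟪t, G (slotSite l)⟫_ℝ = ⟪G.symm t, slotSite l⟫_ℝ := by
    rw [← G.inner_map_map (G.symm t) (slotSite l), G.apply_symm_apply]
  have e2 : ⟪t, m⟫_ℝ = ⟪G.symm t, G.symm m⟫_ℝ := by rw [G.symm.inner_map_map]
  have h2p : 0 < Real.sqrt 2 := Real.sqrt_pos.2 (by norm_num)
  have h3p : 0 < Real.sqrt 3 := Real.sqrt_pos.2 (by norm_num)
  have h22 : Real.sqrt 2 ^ 2 = 2 := Real.sq_sqrt (by norm_num)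
  have h33 : Real.sqrt 3 ^ 2 = 3 := Real.sq_sqrt (by norm_num)
  have h6 : Real.sqrt 6 = Real.sqrt 2 * Real.sqrt 3 := by
    rw [← Real.sqrt_mul (by norm_num : (0 : ℝ) ≤ 2) 3]; norm_num
  rw [inner_sub_right, inner_smul_right, inner_map_slotSite_menu hc l, hsum, e1, inner_slotSite_right, e2,
    inner_eq_cubicCoords (G.symm t) (G.symm m), hc]
  simp only [dotProduct, Fin.sum_univ_three, h6]
  have hc2 : ∀ i, ((cubeInt c i : ℤ) : ℝ) * (cubeInt c i : ℤ) = 1 := fun i => by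
    rcases cubeInt_pm_one c i with h | h <;> simp [h]
  have key : ∀ i, Real.sqrt 2 * cubeInt c i * cubicCoords (G.symm t) i * ((3 * (slotInt l i * cubeInt c i) + 4 : ℤ) : ℝ)
      = 3 * Real.sqrt 2 * (cubicCoords (G.symm t) i * slotInt l i) +
        4 * Real.sqrt 2 * (cubicCoords (G.symm t) i * cubeInt c i) := by
    intro i; push_cast
    linear_combination (3 * Real.sqrt 2 * cubicCoords (G.symm t) i * slotInt l i) * hc2 i
  rw [key 0, key 1, key 2]
  push_cast
  field_simp
  rw [h22, h33]; ring

section Inner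

variable (G : EuclideanSpace ℝ (Fin 3) ≃ₗᵢ[ℝ] EuclideanSpace ℝ (Fin 3)) {m : EuclideanSpace ℝ (Fin 3)} {c : Fin 8}

/-- `18⟪G sₗ, G sₖ⟫ = (3 sₗ c)·(3 sₖ c)`. -/
theorem inner_twin_SS (c : Fin 8) (l k : Fin 12) :
    18 * ⟪G (slotSite l), G (slotSite k)⟫_ℝ =
      ((3 * (slotInt k 0 * cubeInt c 0) * (3 * (slotInt l 0 * cubeInt c 0)) +
        3 * (slotInt k 1 * cubeInt c 1) * (3 * (slotInt l 1 * cubeInt c 1)) +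
        3 * (slotInt k 2 * cubeInt c 2) * (3 * (slotInt l 2 * cubeInt c 2)) : ℤ) : ℝ) := by
  rw [LinearIsometryEquiv.inner_map_map, inner_slotSite]
  have hc2 : ∀ i, ((cubeInt c i : ℤ) : ℝ) * (cubeInt c i : ℤ) = 1 := fun i => by
    rcases cubeInt_pm_one c i with h | h <;> simp [h]
  simp only [dotProduct, Fin.sum_univ_three]
  push_cast
  linear_combination (-(9 * (slotInt k 0 : ℝ) * slotInt l 0)) * hc2 0 - (9 * (slotInt k 1 : ℝ) * slotInt l 1) * hc2 1 -
    (9 * (slotInt k 2 : ℝ) * slotInt l 2) * hc2 2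

/-- `18⟪G sₗ − 2⟪G sₗ, m⟫ m, G sₖ⟫ = (3 sₗ c + 4)·(3 sₖ c)` for a mirror member `l` (`sₗ·c = −2`). -/
theorem inner_twin_MS (hc : cubicCoords (G.symm m) = fun j => (cubeInt c j : ℝ) / Real.sqrt 3)
    (l k : Fin 12) (hl : sdot3 (slotInt l) (cubeInt c) = -2) :
    18 * ⟪G (slotSite l) - (2 * ⟪G (slotSite l), m⟫_ℝ) • m, G (slotSite k)⟫_ℝ =
      ((3 * (slotInt k 0 * cubeInt c 0) * (3 * (slotInt l 0 * cubeInt c 0) + 4) +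
        3 * (slotInt k 1 * cubeInt c 1) * (3 * (slotInt l 1 * cubeInt c 1) + 4) +
        3 * (slotInt k 2 * cubeInt c 2) * (3 * (slotInt l 2 * cubeInt c 2) + 4) : ℤ) : ℝ) := by
  have h6 : Real.sqrt 6 ^ 2 = 6 := Real.sq_sqrt (by norm_num)
  have h6p : 0 < Real.sqrt 6 := Real.sqrt_pos.2 (by norm_num)
  rw [inner_sub_left, inner_smul_left, real_inner_comm (G (slotSite k)) m, inner_map_slotSite_menu hc l,
    inner_map_slotSite_menu hc k, hl, LinearIsometryEquiv.inner_map_map, inner_slotSite]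
  have hc2 : ∀ i, ((cubeInt c i : ℤ) : ℝ) * (cubeInt c i : ℤ) = 1 := fun i => by
    rcases cubeInt_pm_one c i with h | h <;> simp [h]
  simp only [dotProduct, Fin.sum_univ_three, sdot3, starRingEnd_apply, star_trivial]
  push_cast
  field_simp
  rw [h6]
  linear_combination (-(108 * (slotInt k 0 : ℝ) * slotInt l 0)) * hc2 0 - (108 * (slotInt k 1 : ℝ) * slotInt l 1) * hc2 1 -
    (108 * (slotInt k 2 : ℝ) * slotInt l 2) * hc2 2

/-- `18⟪G sₗ − 2⟪G sₗ, m⟫ m, G sₖ − 2⟪G sₖ, m⟫ m⟫ = (3 sₗ c + 4)·(3 sₖ c + 4)` for two mirror members. -/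
theorem inner_twin_MM (hm : ‖m‖ = 1) (hc : cubicCoords (G.symm m) = fun j => (cubeInt c j : ℝ) / Real.sqrt 3)
    (l k : Fin 12) (hl : sdot3 (slotInt l) (cubeInt c) = -2) (hk : sdot3 (slotInt k) (cubeInt c) = -2) :
    18 * ⟪G (slotSite l) - (2 * ⟪G (slotSite l), m⟫_ℝ) • m, G (slotSite k) - (2 * ⟪G (slotSite k), m⟫_ℝ) • m⟫_ℝ =
      (((3 * (slotInt k 0 * cubeInt c 0) + 4) * (3 * (slotInt l 0 * cubeInt c 0) + 4) +
        (3 * (slotInt k 1 * cubeInt c 1) + 4) * (3 * (slotInt l 1 * cubeInt c 1) + 4) +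
        (3 * (slotInt k 2 * cubeInt c 2) + 4) * (3 * (slotInt l 2 * cubeInt c 2) + 4) : ℤ) : ℝ) := by
  have hmm : ⟪m, m⟫_ℝ = 1 := by rw [real_inner_self_eq_norm_sq, hm, one_pow]
  have h6 : Real.sqrt 6 ^ 2 = 6 := Real.sq_sqrt (by norm_num)
  have h6p : 0 < Real.sqrt 6 := Real.sqrt_pos.2 (by norm_num)
  rw [inner_sub_left, inner_smul_left, inner_sub_right, inner_sub_right, inner_smul_right, inner_smul_right,
    real_inner_comm (G (slotSite k)) m, hmm, inner_map_slotSite_menu hc l, inner_map_slotSite_menu hc k, hl, hk,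
    LinearIsometryEquiv.inner_map_map, inner_slotSite]
  have hc2 : ∀ i, ((cubeInt c i : ℤ) : ℝ) * (cubeInt c i : ℤ) = 1 := fun i => by
    rcases cubeInt_pm_one c i with h | h <;> simp [h]
  have hsl : ((slotInt l 0 * cubeInt c 0 + slotInt l 1 * cubeInt c 1 + slotInt l 2 * cubeInt c 2 : ℤ) : ℝ) = -2 := by
    have := hl; simp only [sdot3] at this; exact_mod_cast this
  have hsk : ((slotInt k 0 * cubeInt c 0 + slotInt k 1 * cubeInt c 1 + slotInt k 2 * cubeInt c 2 : ℤ) : ℝ) = -2 := by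
    have := hk; simp only [sdot3] at this; exact_mod_cast this
  push_cast at hsl hsk
  simp only [dotProduct, Fin.sum_univ_three, starRingEnd_apply, star_trivial]
  push_cast
  field_simp
  rw [h6]
  linear_combination (-(108 * (slotInt k 0 : ℝ) * slotInt l 0)) * hc2 0 - (108 * (slotInt k 1 : ℝ) * slotInt l 1) * hc2 1 -
    (108 * (slotInt k 2 : ℝ) * slotInt l 2) * hc2 2 - 144 * hsl - 144 * hsk

end Inner

/-- **Covering cell** for the twin table: no `x` with `Σ xᵢ² = 2` has `x·τ < 3` for all twelve entries. -/
theorem twin_cover_core (x : Fin 3 → ℝ) (hn : x 0 ^ 2 + x 1 ^ 2 + x 2 ^ 2 = 2)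
    (g0 : 3 * x 0 - 3 * x 1 < 3) (g1 : -3 * x 0 + 3 * x 1 < 3) (g2 : -3 * x 0 - 3 * x 1 < 3)
    (g3 : 3 * x 0 - 3 * x 2 < 3) (g4 : -3 * x 0 + 3 * x 2 < 3) (g5 : -3 * x 0 - 3 * x 2 < 3)
    (g6 : 3 * x 1 - 3 * x 2 < 3) (g7 : -3 * x 1 + 3 * x 2 < 3) (g8 : -3 * x 1 - 3 * x 2 < 3)
    (m1 : x 0 + x 1 + 4 * x 2 < 3) (m2 : x 0 + 4 * x 1 + x 2 < 3) (m3 : 4 * x 0 + x 1 + x 2 < 3) : False := by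
  nlinarith [mul_pos (sub_pos.2 g0) (sub_pos.2 g1), mul_pos (sub_pos.2 g3) (sub_pos.2 g4), mul_pos (sub_pos.2 g6) (sub_pos.2 g7),
    mul_pos (sub_pos.2 g2) (sub_pos.2 m1), mul_pos (sub_pos.2 g5) (sub_pos.2 m2), mul_pos (sub_pos.2 g8) (sub_pos.2 m3),
    mul_pos (sub_pos.2 g2) (sub_pos.2 m2), mul_pos (sub_pos.2 g2) (sub_pos.2 m3),
    mul_pos (sub_pos.2 g5) (sub_pos.2 m1), mul_pos (sub_pos.2 g5) (sub_pos.2 m3),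
    mul_pos (sub_pos.2 g8) (sub_pos.2 m1), mul_pos (sub_pos.2 g8) (sub_pos.2 m2),
    mul_pos (sub_pos.2 m1) (sub_pos.2 m2), mul_pos (sub_pos.2 m1) (sub_pos.2 m3), mul_pos (sub_pos.2 m2) (sub_pos.2 m3),
    sq_nonneg (x 0 + x 1 + x 2), sq_nonneg (x 0 - x 1), sq_nonneg (x 1 - x 2), sq_nonneg (x 0 - x 2)]

section Geometry

variable (G : EuclideanSpace ℝ (Fin 3) ≃ₗᵢ[ℝ] EuclideanSpace ℝ (Fin 3)) {m : EuclideanSpace ℝ (Fin 3)}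

/-- Bookkeeping shared by the geometric statements: sign conditions and dozen membership from the table. -/
theorem twin_sgn_mem {c : Fin 8}
    (hc : cubicCoords (G.symm m) = fun j => (cubeInt c j : ℝ) / Real.sqrt 3) (l : Fin 12) :
    (⟪G (slotSite l), m⟫_ℝ ≤ 0 ↔ sdot3 (slotInt l) (cubeInt c) ≤ 0) ∧
    (⟪G (slotSite l), m⟫_ℝ < 0 ↔ sdot3 (slotInt l) (cubeInt c) = -2) ∧
    (sdot3 (slotInt l) (cubeInt c) ≤ 0 → G (slotSite l) ∈ ((fccSlots.filter fun w => ⟪G w, m⟫_ℝ ≤ 0).image fun w => G w) ∪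
        ((fccSlots.filter fun w => ⟪G w, m⟫_ℝ < 0).image fun w => G w - (2 * ⟪G w, m⟫_ℝ) • m)) ∧
    (sdot3 (slotInt l) (cubeInt c) = -2 → G (slotSite l) - (2 * ⟪G (slotSite l), m⟫_ℝ) • m ∈ ((fccSlots.filter fun w => ⟪G w, m⟫_ℝ ≤ 0).image fun w => G w) ∪
        ((fccSlots.filter fun w => ⟪G w, m⟫_ℝ < 0).image fun w => G w - (2 * ⟪G w, m⟫_ℝ) • m)) := by
  classical
  have h6p : 0 < Real.sqrt 6 := Real.sqrt_pos.2 (by norm_num)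
  have sgn_le : ⟪G (slotSite l), m⟫_ℝ ≤ 0 ↔ sdot3 (slotInt l) (cubeInt c) ≤ 0 := by
    rw [inner_map_slotSite_menu hc l, div_nonpos_iff]
    constructor
    · rintro (⟨_, h0⟩ | ⟨h0, _⟩)
      · exact absurd h0 (not_le.2 h6p)
      · exact_mod_cast h0
    · intro h0; exact Or.inr ⟨by exact_mod_cast h0, h6p.le⟩
  have sgn_lt : ⟪G (slotSite l), m⟫_ℝ < 0 ↔ sdot3 (slotInt l) (cubeInt c) = -2 := by
    rw [inner_map_slotSite_menu hc l, div_neg_iff]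
    constructor
    · rintro (⟨_, h0⟩ | ⟨h0, _⟩)
      · exact absurd h0 (not_lt.2 h6p.le)
      · exact sdot3_eq_neg_two_of_neg c l (by exact_mod_cast h0)
    · intro h0; exact Or.inr ⟨by rw [h0]; norm_num, h6p⟩
  exact ⟨sgn_le, sgn_lt, fun hl => (mem_twinDozenVec_iff G m _).2 (Or.inl ⟨slotSite l, slotSite_mem l, sgn_le.2 hl, rfl⟩),
    fun hl => (mem_twinDozenVec_iff G m _).2 (Or.inr ⟨slotSite l, slotSite_mem l, sgn_lt.2 hl, rfl⟩)⟩

/-- **The twin dozen's closed `60°`-caps cover the sphere.** -/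
theorem exists_twinMember_inner_ge_half (hm : IsMenuNormal G m) {t : EuclideanSpace ℝ (Fin 3)} (ht : ‖t‖ = 1) :
    ∃ d ∈ ((fccSlots.filter fun w => ⟪G w, m⟫_ℝ ≤ 0).image fun w => G w) ∪
        ((fccSlots.filter fun w => ⟪G w, m⟫_ℝ < 0).image fun w => G w - (2 * ⟪G w, m⟫_ℝ) • m), 1 / 2 ≤ ⟪t, d⟫_ℝ := by
  classical
  by_contra hcon
  push Not at hcon
  obtain ⟨c, hc⟩ := exists_cubeInt_of_menu_normal G hm.1 hm.2
  have hs1 : ‖G.symm t‖ = 1 := by rw [LinearIsometryEquiv.norm_map, ht]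
  have hn := twin_x_sq c hs1
  set x : Fin 3 → ℝ := fun i => Real.sqrt 2 * cubeInt c i * cubicCoords (G.symm t) i with hx
  -- every table entry reads `< 3`
  have hlt : ∀ τ ∈ ({(3, -3, 0), (-3, 3, 0), (-3, -3, 0), (3, 0, -3), (-3, 0, 3), (-3, 0, -3), (0, 3, -3), (0, -3, 3),
      (0, -3, -3), (1, 1, 4), (1, 4, 1), (4, 1, 1)} : Finset (ℤ × ℤ × ℤ)),
      x 0 * τ.1 + x 1 * τ.2.1 + x 2 * τ.2.2 < 3 := by
    intro τ hτ
    rcases twin_table_cover c τ hτ with ⟨l, hl, rfl⟩ | ⟨l, hl, rfl⟩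
    · have h1 := hcon _ ((twin_sgn_mem G hc l).2.2.1 hl)
      have := twin_slot_eq G c t l
      simp only [hx]
      linarith
    · have h1 := hcon _ ((twin_sgn_mem G hc l).2.2.2 hl)
      have := twin_mirror_eq hc t l hl
      simp only [hx]
      linarith
  have g0 := hlt (3, -3, 0) (by decide)
  have g1 := hlt (-3, 3, 0) (by decide)
  have g2 := hlt (-3, -3, 0) (by decide)
  have g3 := hlt (3, 0, -3) (by decide)
  have g4 := hlt (-3, 0, 3) (by decide)
  have g5 := hlt (-3, 0, -3) (by decide)
  have g6 := hlt (0, 3, -3) (by decide)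
  have g7 := hlt (0, -3, 3) (by decide)
  have g8 := hlt (0, -3, -3) (by decide)
  have g9 := hlt (1, 1, 4) (by decide)
  have g10 := hlt (1, 4, 1) (by decide)
  have g11 := hlt (4, 1, 1) (by decide)
  norm_num at g0 g1 g2 g3 g4 g5 g6 g7 g8 g9 g10 g11
  exact twin_cover_core x hn (by linarith) (by linarith) (by linarith) (by linarith) (by linarith) (by linarith)
    (by linarith) (by linarith) (by linarith) (by linarith) (by linarith) (by linarith)

/-- **THE LOCAL TWIN CAGE.**  For any frame `G`, menu normal `m`, member `d₀` of the twin dozen and unit `t`: if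
`⟪t, d₀⟫ ≥ ½` and `⟪t, d⟫ ≤ ½` for the (four) members `d` adjacent to `d₀` (`⟪d, d₀⟫ = ½`), then `t = d₀`. -/
theorem eq_of_twin_local_cage (hm : IsMenuNormal G m) {t : EuclideanSpace ℝ (Fin 3)} (ht : ‖t‖ = 1)
    {d₀ : EuclideanSpace ℝ (Fin 3)} (hd₀ : d₀ ∈ ((fccSlots.filter fun w => ⟪G w, m⟫_ℝ ≤ 0).image fun w => G w) ∪
        ((fccSlots.filter fun w => ⟪G w, m⟫_ℝ < 0).image fun w => G w - (2 * ⟪G w, m⟫_ℝ) • m)) (hcap : 1 / 2 ≤ ⟪t, d₀⟫_ℝ)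
    (h : ∀ d ∈ ((fccSlots.filter fun w => ⟪G w, m⟫_ℝ ≤ 0).image fun w => G w) ∪
        ((fccSlots.filter fun w => ⟪G w, m⟫_ℝ < 0).image fun w => G w - (2 * ⟪G w, m⟫_ℝ) • m), ⟪d, d₀⟫_ℝ = 1 / 2 → ⟪t, d⟫_ℝ ≤ 1 / 2) : t = d₀ := by
  classical
  obtain ⟨c, hc⟩ := exists_cubeInt_of_menu_normal G hm.1 hm.2
  have hs1 : ‖G.symm t‖ = 1 := by rw [LinearIsometryEquiv.norm_map, ht]
  have hn := twin_x_sq c hs1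
  set x : Fin 3 → ℝ := fun i => Real.sqrt 2 * cubeInt c i * cubicCoords (G.symm t) i with hx
  rcases (mem_twinDozenVec_iff G m d₀).1 hd₀ with ⟨w₀, hw₀, hle₀, rfl⟩ | ⟨w₀, hw₀, hlt₀, rfl⟩
  · -- slot target
    obtain ⟨l₀, rfl⟩ := exists_slotSite_eq hw₀
    have hsum₀ := (twin_sgn_mem G hc l₀).1.1 hle₀
    have hcap' : 3 ≤ x 0 * ((3 * (slotInt l₀ 0 * cubeInt c 0) : ℤ) : ℝ) + x 1 * ((3 * (slotInt l₀ 1 * cubeInt c 1) : ℤ) : ℝ) +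
        x 2 * ((3 * (slotInt l₀ 2 * cubeInt c 2) : ℤ) : ℝ) := by
      have := twin_slot_eq G c t l₀; simp only [hx]; linarith
    have H : ∀ τ ∈ ({(3, -3, 0), (-3, 3, 0), (-3, -3, 0), (3, 0, -3), (-3, 0, 3), (-3, 0, -3), (0, 3, -3), (0, -3, 3),
        (0, -3, -3), (1, 1, 4), (1, 4, 1), (4, 1, 1)} : Finset (ℤ × ℤ × ℤ)),
        3 * (slotInt l₀ 0 * cubeInt c 0) * τ.1 + 3 * (slotInt l₀ 1 * cubeInt c 1) * τ.2.1 +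
          3 * (slotInt l₀ 2 * cubeInt c 2) * τ.2.2 = 9 →
        x 0 * τ.1 + x 1 * τ.2.1 + x 2 * τ.2.2 ≤ 3 := by
      intro τ hτ h9
      rcases twin_table_cover c τ hτ with ⟨l, hl, rfl⟩ | ⟨l, hl, rfl⟩
      · have hadj : ⟪G (slotSite l), G (slotSite l₀)⟫_ℝ = 1 / 2 := by
          have e := inner_twin_SS G c l l₀
          have h9' : (((3 * (slotInt l₀ 0 * cubeInt c 0) * (3 * (slotInt l 0 * cubeInt c 0)) +
              3 * (slotInt l₀ 1 * cubeInt c 1) * (3 * (slotInt l 1 * cubeInt c 1)) +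
              3 * (slotInt l₀ 2 * cubeInt c 2) * (3 * (slotInt l 2 * cubeInt c 2)) : ℤ)) : ℝ) = 9 := by
            exact_mod_cast h9
          linarith
        have := twin_slot_eq G c t l
        have h1 := h _ ((twin_sgn_mem G hc l).2.2.1 hl) hadj
        simp only [hx]; linarith
      · have hadj : ⟪G (slotSite l) - (2 * ⟪G (slotSite l), m⟫_ℝ) • m, G (slotSite l₀)⟫_ℝ = 1 / 2 := by
          have e := inner_twin_MS G hc l l₀ hl
          have h9' : (((3 * (slotInt l₀ 0 * cubeInt c 0) * (3 * (slotInt l 0 * cubeInt c 0) + 4) +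
              3 * (slotInt l₀ 1 * cubeInt c 1) * (3 * (slotInt l 1 * cubeInt c 1) + 4) +
              3 * (slotInt l₀ 2 * cubeInt c 2) * (3 * (slotInt l 2 * cubeInt c 2) + 4) : ℤ)) : ℝ) = 9 := by
            exact_mod_cast h9
          linarith
        have := twin_mirror_eq hc t l hl
        have h1 := h _ ((twin_sgn_mem G hc l).2.2.2 hl) hadj
        simp only [hx]; linarith
    obtain ⟨e0, e1, e2⟩ := twin_local_core_triple x hn _ _ _ (twin_table_slot c l₀ hsum₀) (by push_cast at hcap' ⊢; linarith) H
    refine eq_slot_of_twin_coords G c l₀ fun i => ?_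
    fin_cases i
    · exact e0
    · exact e1
    · exact e2
  · -- mirror target
    obtain ⟨l₀, rfl⟩ := exists_slotSite_eq hw₀
    have hsum₀ := (twin_sgn_mem G hc l₀).2.1.1 hlt₀
    have hcap' : 3 ≤ x 0 * ((3 * (slotInt l₀ 0 * cubeInt c 0) + 4 : ℤ) : ℝ) +
        x 1 * ((3 * (slotInt l₀ 1 * cubeInt c 1) + 4 : ℤ) : ℝ) + x 2 * ((3 * (slotInt l₀ 2 * cubeInt c 2) + 4 : ℤ) : ℝ) := by
      have := twin_mirror_eq hc t l₀ hsum₀; simp only [hx]; linarith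
    have H : ∀ τ ∈ ({(3, -3, 0), (-3, 3, 0), (-3, -3, 0), (3, 0, -3), (-3, 0, 3), (-3, 0, -3), (0, 3, -3), (0, -3, 3),
        (0, -3, -3), (1, 1, 4), (1, 4, 1), (4, 1, 1)} : Finset (ℤ × ℤ × ℤ)),
        (3 * (slotInt l₀ 0 * cubeInt c 0) + 4) * τ.1 + (3 * (slotInt l₀ 1 * cubeInt c 1) + 4) * τ.2.1 +
          (3 * (slotInt l₀ 2 * cubeInt c 2) + 4) * τ.2.2 = 9 →
        x 0 * τ.1 + x 1 * τ.2.1 + x 2 * τ.2.2 ≤ 3 := by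
      intro τ hτ h9
      rcases twin_table_cover c τ hτ with ⟨l, hl, rfl⟩ | ⟨l, hl, rfl⟩
      · have hadj : ⟪G (slotSite l), G (slotSite l₀) - (2 * ⟪G (slotSite l₀), m⟫_ℝ) • m⟫_ℝ = 1 / 2 := by
          rw [real_inner_comm]
          have e := inner_twin_MS G hc l₀ l hsum₀
          have h9' : (((3 * (slotInt l 0 * cubeInt c 0) * (3 * (slotInt l₀ 0 * cubeInt c 0) + 4) +
              3 * (slotInt l 1 * cubeInt c 1) * (3 * (slotInt l₀ 1 * cubeInt c 1) + 4) +
              3 * (slotInt l 2 * cubeInt c 2) * (3 * (slotInt l₀ 2 * cubeInt c 2) + 4) : ℤ)) : ℝ) = 9 := by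
            have h9z : (3 * (slotInt l 0 * cubeInt c 0) * (3 * (slotInt l₀ 0 * cubeInt c 0) + 4) +
                3 * (slotInt l 1 * cubeInt c 1) * (3 * (slotInt l₀ 1 * cubeInt c 1) + 4) +
                3 * (slotInt l 2 * cubeInt c 2) * (3 * (slotInt l₀ 2 * cubeInt c 2) + 4) : ℤ) = 9 := by
              linear_combination h9
            exact_mod_cast h9z
          linarith
        have := twin_slot_eq G c t l
        have h1 := h _ ((twin_sgn_mem G hc l).2.2.1 hl) hadj
        simp only [hx]; linarith
      · have hadj : ⟪G (slotSite l) - (2 * ⟪G (slotSite l), m⟫_ℝ) • m,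
            G (slotSite l₀) - (2 * ⟪G (slotSite l₀), m⟫_ℝ) • m⟫_ℝ = 1 / 2 := by
          have e := inner_twin_MM G hm.1 hc l l₀ hl hsum₀
          have h9' : ((((3 * (slotInt l₀ 0 * cubeInt c 0) + 4) * (3 * (slotInt l 0 * cubeInt c 0) + 4) +
              (3 * (slotInt l₀ 1 * cubeInt c 1) + 4) * (3 * (slotInt l 1 * cubeInt c 1) + 4) +
              (3 * (slotInt l₀ 2 * cubeInt c 2) + 4) * (3 * (slotInt l 2 * cubeInt c 2) + 4) : ℤ)) : ℝ) = 9 := by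
            exact_mod_cast h9
          linarith
        have := twin_mirror_eq hc t l hl
        have h1 := h _ ((twin_sgn_mem G hc l).2.2.2 hl) hadj
        simp only [hx]; linarith
    obtain ⟨e0, e1, e2⟩ := twin_local_core_triple x hn _ _ _ (twin_table_mirror c l₀ hsum₀) (by push_cast at hcap' ⊢; linarith) H
    refine eq_mirror_of_twin_coords hc l₀ hsum₀ fun i => ?_
    fin_cases i
    · exact e0
    · exact e1
    · exact e2

/-- One step: `⟪t, d₀⟫ ≥ ½` and `t ≠ d₀` give an adjacent member strictly blocked. -/
theorem exists_adjacent_twin_gt_half (hm : IsMenuNormal G m) {t : EuclideanSpace ℝ (Fin 3)} (ht : ‖t‖ = 1)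
    {d₀ : EuclideanSpace ℝ (Fin 3)} (hd₀ : d₀ ∈ ((fccSlots.filter fun w => ⟪G w, m⟫_ℝ ≤ 0).image fun w => G w) ∪
        ((fccSlots.filter fun w => ⟪G w, m⟫_ℝ < 0).image fun w => G w - (2 * ⟪G w, m⟫_ℝ) • m)) (hcap : 1 / 2 ≤ ⟪t, d₀⟫_ℝ) (hne : t ≠ d₀) :
    ∃ d ∈ ((fccSlots.filter fun w => ⟪G w, m⟫_ℝ ≤ 0).image fun w => G w) ∪
        ((fccSlots.filter fun w => ⟪G w, m⟫_ℝ < 0).image fun w => G w - (2 * ⟪G w, m⟫_ℝ) • m), ⟪d, d₀⟫_ℝ = 1 / 2 ∧ 1 / 2 < ⟪t, d⟫_ℝ := by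
  by_contra hcon
  push Not at hcon
  exact hne (eq_of_twin_local_cage G hm ht hd₀ hcap fun d hd hadj => hcon d hd hadj)

/-- Members of the twin dozen are unit vectors. -/
theorem norm_eq_one_of_mem_twinDozen (hm : ‖m‖ = 1) {d : EuclideanSpace ℝ (Fin 3)} (hd : d ∈ ((fccSlots.filter fun w => ⟪G w, m⟫_ℝ ≤ 0).image fun w => G w) ∪
        ((fccSlots.filter fun w => ⟪G w, m⟫_ℝ < 0).image fun w => G w - (2 * ⟪G w, m⟫_ℝ) • m)) : ‖d‖ = 1 := by
  classical
  rcases (mem_twinDozenVec_iff G m d).1 hd with ⟨w, hw, -, rfl⟩ | ⟨w, hw, -, rfl⟩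
  · rw [LinearIsometryEquiv.norm_map, norm_eq_one_of_mem_fccSlots hw]
  · exact norm_reflectStep_slot G hm hw

/-- **THE DIVACANCY LAW AT TWIN HOSTS.**  `X` `1`-separated, `x ∈ X` touching `y` off the twin dozen `y + D`: two
ADJACENT members `d, d′` (`⟪d, d′⟫ = ½`) are vacant at `y` and strictly blocked by `x`. -/
theorem foreign_contact_twin_adjacent_divacancy {X : Finset (EuclideanSpace ℝ (Fin 3))}
    (hX : ∀ p ∈ X, ∀ q ∈ X, p ≠ q → 1 ≤ dist p q) (hm : IsMenuNormal G m) {y x : EuclideanSpace ℝ (Fin 3)}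
    (hx : x ∈ X) (hd : dist x y = 1) (hoff : ∀ d ∈ ((fccSlots.filter fun w => ⟪G w, m⟫_ℝ ≤ 0).image fun w => G w) ∪
        ((fccSlots.filter fun w => ⟪G w, m⟫_ℝ < 0).image fun w => G w - (2 * ⟪G w, m⟫_ℝ) • m), x ≠ y + d) :
    ∃ d ∈ ((fccSlots.filter fun w => ⟪G w, m⟫_ℝ ≤ 0).image fun w => G w) ∪
        ((fccSlots.filter fun w => ⟪G w, m⟫_ℝ < 0).image fun w => G w - (2 * ⟪G w, m⟫_ℝ) • m), ∃ d' ∈ ((fccSlots.filter fun w => ⟪G w, m⟫_ℝ ≤ 0).image fun w => G w) ∪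
        ((fccSlots.filter fun w => ⟪G w, m⟫_ℝ < 0).image fun w => G w - (2 * ⟪G w, m⟫_ℝ) • m), ⟪d', d⟫_ℝ = 1 / 2 ∧ y + d ∉ X ∧ y + d' ∉ X ∧
      1 / 2 < ⟪x - y, d⟫_ℝ ∧ 1 / 2 < ⟪x - y, d'⟫_ℝ := by
  have ht : ‖x - y‖ = 1 := by rwa [← dist_eq_norm]
  have hne : ∀ d ∈ ((fccSlots.filter fun w => ⟪G w, m⟫_ℝ ≤ 0).image fun w => G w) ∪
        ((fccSlots.filter fun w => ⟪G w, m⟫_ℝ < 0).image fun w => G w - (2 * ⟪G w, m⟫_ℝ) • m), x - y ≠ d := by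
    intro d hd' heq; exact hoff d hd' (by rw [← heq]; abel)
  have vac : ∀ d ∈ ((fccSlots.filter fun w => ⟪G w, m⟫_ℝ ≤ 0).image fun w => G w) ∪
        ((fccSlots.filter fun w => ⟪G w, m⟫_ℝ < 0).image fun w => G w - (2 * ⟪G w, m⟫_ℝ) • m), 1 / 2 < ⟪x - y, d⟫_ℝ → y + d ∉ X := by
    intro d hd' hblock hocc
    have hsep := hX x hx (y + d) hocc (hoff d hd')
    rw [dist_eq_norm, show x - (y + d) = x - y - d by abel] at hsep
    have := inner_le_half_of_norm_sub_ge_one ht (norm_eq_one_of_mem_twinDozen G hm.1 hd') hsep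
    linarith
  obtain ⟨d₀, hd₀, hcap₀⟩ := exists_twinMember_inner_ge_half G hm ht
  obtain ⟨d, hdD, -, hd'⟩ := exists_adjacent_twin_gt_half G hm ht hd₀ hcap₀ (hne d₀ hd₀)
  obtain ⟨d', hd'D, hadj, hd''⟩ := exists_adjacent_twin_gt_half G hm ht hdD hd'.le (hne d hdD)
  exact ⟨d, hdD, d', hd'D, hadj, vac d hdD hd', vac d' hd'D hd'', hd', hd''⟩

/-- **Twin hosts without an adjacent divacancy are caged**: every ball of `X` touching `y` is `y + d`, `d` in the dozen. -/
theorem contact_on_twinDozen_of_no_adjacent_divacancy {X : Finset (EuclideanSpace ℝ (Fin 3))}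
    (hX : ∀ p ∈ X, ∀ q ∈ X, p ≠ q → 1 ≤ dist p q) (hm : IsMenuNormal G m) {y x : EuclideanSpace ℝ (Fin 3)}
    (hx : x ∈ X) (hd : dist x y = 1)
    (hnodi : ∀ d ∈ ((fccSlots.filter fun w => ⟪G w, m⟫_ℝ ≤ 0).image fun w => G w) ∪
        ((fccSlots.filter fun w => ⟪G w, m⟫_ℝ < 0).image fun w => G w - (2 * ⟪G w, m⟫_ℝ) • m), ∀ d' ∈ ((fccSlots.filter fun w => ⟪G w, m⟫_ℝ ≤ 0).image fun w => G w) ∪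
        ((fccSlots.filter fun w => ⟪G w, m⟫_ℝ < 0).image fun w => G w - (2 * ⟪G w, m⟫_ℝ) • m), ⟪d', d⟫_ℝ = 1 / 2 → y + d ∈ X ∨ y + d' ∈ X) :
    ∃ d ∈ ((fccSlots.filter fun w => ⟪G w, m⟫_ℝ ≤ 0).image fun w => G w) ∪
        ((fccSlots.filter fun w => ⟪G w, m⟫_ℝ < 0).image fun w => G w - (2 * ⟪G w, m⟫_ℝ) • m), x = y + d := by
  by_contra hoff
  push Not at hoff
  obtain ⟨d, hdD, d', hd'D, hadj, hv, hv', -, -⟩ := foreign_contact_twin_adjacent_divacancy G hX hm hx hd hoff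
  rcases hnodi d hdD d' hd'D hadj with h | h
  · exact hv h
  · exact hv' h

end Geometry

end Summit.Ventures.Crystal3D.Theorems

end
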